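import Summits.Parity.GeneralizedHardyLittlewood.Theorems.ChenParityOracleBLAPHostParityFromBrickTypeI
import Summits.Parity.GeneralizedHardyLittlewood.Theorems.ChenParityOracleBLAPHostParityFromBrickSifting
import Summits.Parity.GeneralizedHardyLittlewood.Theorems.ChenParityOracleBLAPHostParityFromBrickSparseTau
import Summits.Parity.GeneralizedHardyLittlewood.Theorems.ChenParityOracleBLAPHostParityFromBrickSiftedPairs
import Summits.Parity.GeneralizedHardyLittlewood.Theorems.ChenParityOracleBLAPHostParityFromBrickSiftedTail
import HarnessLib

/-!
# Route `ChenParityOracleBLAP` — crux S1 = `HostParityFromBrick` (stmt-Parity-20045): the sifted Type-I theorem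

Support file for the prime half `K1 → K2 → HP1` of S1: the Type-I input in the form produced by
Vaughan's identity on `w₀`-rough integers — an outer rough variable `b ≤ x^{1/3−δ}` with bounded
coefficients and an inner ROUGH variable `t ≤ u/b` (`sifted_typeI`):
`∑_{d ≤ x^{1/2−ε} odd} |∑_{b ≤ x^{1/3−δ}} c_b ∑_{t ≤ u/b, (t,(N−1)#)=1} [d ∣ bt+2] λ(bt+2)| ≤ x/(log x)^A`
for `x ≥ x₀`, `u ≤ x`, `3 ≤ N ≤ x`, `2c ≤ log N ≤ 2 log x/log log x`.  Proof: truncated sifting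
identity (`…Sifting`), collection of `(b,e) ↦ be` (`…SiftedPairs`), the unconditional Type-I theorem
(`typeI_shifted_liouville`) for the main term, and the sparse-set tail (`…SiftedTail`,
`sparse_tau_sum_le`).

References: H. Iwaniec, E. Kowalski, *Analytic Number Theory* (2004), §13.4, Thm 17.4
[IwaniecKowalski2004]; E. Bombieri, J. B. Friedlander, H. Iwaniec, Acta Math. 156 (1986), Thm 0
[BombieriFriedlanderIwaniecActa1986].
-/

namespace Summit.Parity.GeneralizedHardyLittlewood.Theorems

open Finset Real
open scoped ArithmeticFunction.sigma
open ArithmeticFunction (liouville moebius sigma)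

/-- An integer coprime to `(N−1)#` with `N ≥ 3` is odd. -/
theorem odd_of_coprime_primorial {N t : ℕ} (hN : 3 ≤ N) (h : Nat.Coprime t (primorial (N - 1))) :
    Odd t := by
  have h2 : 2 ∣ primorial (N - 1) := Nat.prime_two.dvd_primorial_iff.2 (by omega)
  rw [Nat.odd_iff]
  by_contra hne
  have ht2 : 2 ∣ t := Nat.dvd_of_mod_eq_zero (by omega)
  have := Nat.dvd_gcd ht2 h2
  rw [h.gcd_eq_one] at this
  omega

set_option maxHeartbeats 800000 in
/-- **The sifted Type-I theorem.**  For `A > 0`, `0 < δ ≤ 1/12`, `0 ≤ ε` there are `x₀` and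
`c > 0` such that for all `x ≥ x₀`, `u ≤ x`, `3 ≤ N ≤ x` with `2c ≤ log N ≤ 2 log x/log log x`, and
all coefficients `|c_b| ≤ 1` supported on `b` coprime to `(N−1)#`:
`∑_{d ≤ ⌊x^{1/2−ε}⌋ odd} |∑_{b ≤ ⌊x^{1/3−δ}⌋} c_b ∑_{t ≤ u/b, (t,(N−1)#)=1} [d ∣ bt+2] λ(bt+2)| ≤ x/(log x)^A`
[cite: IwaniecKowalski2004, Theorem 17.4; BombieriFriedlanderIwaniecActa1986, Theorem 0]. -/
theorem sifted_typeI (A δ ε : ℝ) (hA : 0 < A) (hδ : 0 < δ) (hδ' : δ ≤ 1 / 12) (hε : 0 ≤ ε) :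
    ∃ x₀ c : ℝ, 0 < c ∧ ∀ x : ℕ, x₀ ≤ (x : ℝ) → ∀ u : ℕ, u ≤ x → ∀ N : ℕ, 3 ≤ N → (N : ℝ) ≤ x →
      2 * c ≤ Real.log N → Real.log N ≤ 2 * Real.log x / Real.log (Real.log x) →
      ∀ cb : ℕ → ℝ, (∀ b, |cb b| ≤ 1) → (∀ b, cb b ≠ 0 → Nat.Coprime b (primorial (N - 1))) →
      ∑ d ∈ (Icc 1 ⌊(x : ℝ) ^ (1 / 2 - ε)⌋₊).filter (fun d => Odd d),
        |∑ b ∈ Icc 1 ⌊(x : ℝ) ^ (1 / 3 - δ)⌋₊, cb b *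
          ∑ t ∈ (Icc 1 (u / b)).filter (fun t => Nat.Coprime t (primorial (N - 1))),
            (if d ∣ b * t + 2 then (liouville (b * t + 2) : ℝ) else 0)| ≤
        (x : ℝ) / Real.log x ^ A := by
  classical
  obtain ⟨x₁, hT⟩ := typeI_shifted_liouville (A + 1) (δ / 2) ε (by positivity) (by positivity)
    (by linarith) hε
  obtain ⟨K, c, hK, hc, hS⟩ := sparse_tau_sum_le A (δ / 2) hA (by positivity)
  refine ⟨max x₁ (max 16 (Real.exp (K + 1))), c, hc, ?_⟩
  intro x hx u hu N hN hNx hcN hNhi cb hcb1 hcbP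
  have hx₁ : x₁ ≤ x := le_trans (le_max_left _ _) hx
  have hx16 : (16 : ℝ) ≤ x := le_trans (le_trans (le_max_left _ _) (le_max_right _ _)) hx
  have hxK : Real.exp (K + 1) ≤ x := le_trans (le_trans (le_max_right _ _) (le_max_right _ _)) hx
  have hx0 : (0 : ℝ) < x := by linarith only [hx16]
  have hx1 : (1 : ℝ) ≤ x := by linarith only [hx16]
  have hlogK : K + 1 ≤ Real.log x := by
    have := Real.log_le_log (Real.exp_pos _) hxK; rwa [Real.log_exp] at this
  have hlog0 : 0 < Real.log x := by linarith only [hlogK, hK]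
  set P : ℕ := primorial (N - 1) with hPdef
  have hP0 : P ≠ 0 := primorial_ne_zero _
  set B : ℕ := ⌊(x : ℝ) ^ (1 / 3 - δ)⌋₊ with hBdef
  set Y : ℝ := (x : ℝ) ^ (δ / 2) with hYdef
  set R : ℕ := ⌊(x : ℝ) ^ (1 / 3 - δ / 2)⌋₊ with hRdef
  set Dset := (Icc 1 ⌊(x : ℝ) ^ (1 / 2 - ε)⌋₊).filter (fun d => Odd d) with hDset
  set E := (P.divisors.filter (fun e : ℕ => (e : ℝ) < Y)).filter (fun e => Odd e) with hEdef
  set Sp : ℕ → Finset ℕ := fun v => (Icc 1 v).filter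
    (fun k => ∃ e ∈ k.divisors, e ∈ Nat.smoothNumbers N ∧ Y ≤ (e : ℝ)) with hSp
  set G : ℕ → ℕ → ℝ := fun d r => ∑ s ∈ (Icc 1 (u / r)).filter (fun s => Odd s ∧ d ∣ r * s + 2),
    (liouville (r * s + 2) : ℝ) with hGdef
  -- collected coefficients
  have hEdiv : ∀ e ∈ E, e ∣ P := by
    intro e he
    simp only [hEdef, Finset.mem_filter] at he
    exact Nat.dvd_of_mem_divisors he.1.1
  have hbeR : ∀ b ∈ Icc 1 B, ∀ e ∈ E, b * e ≤ R := by
    intro b hb e he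
    rw [Finset.mem_Icc] at hb
    simp only [hEdef, Finset.mem_filter] at he
    have hbx : (b : ℝ) ≤ (x : ℝ) ^ (1 / 3 - δ) :=
      le_trans (by exact_mod_cast hb.2) (Nat.floor_le (by positivity))
    have hey : (e : ℝ) < Y := he.1.2
    have h1 : ((b * e : ℕ) : ℝ) ≤ (x : ℝ) ^ (1 / 3 - δ / 2) := by
      push_cast
      calc (b : ℝ) * e ≤ (x : ℝ) ^ (1 / 3 - δ) * Y :=
            mul_le_mul hbx hey.le (Nat.cast_nonneg e) (by positivity)
        _ = (x : ℝ) ^ (1 / 3 - δ / 2) := by rw [hYdef, ← Real.rpow_add hx0]; ring_nf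
    exact Nat.le_floor h1
  obtain ⟨C, hC1, hCsupp, hCid⟩ := sum_pairs_eq_sum_collected hP0 cb hcb1 hcbP E hEdiv hbeR
  have hCodd : ∀ r, C r ≠ 0 → Odd r := by
    intro r hr
    obtain ⟨b, -, e, he, hcb, rfl⟩ := hCsupp r hr
    simp only [hEdef, Finset.mem_filter] at he
    exact Nat.odd_mul.2 ⟨odd_of_coprime_primorial hN (hcbP b hcb), he.2⟩
  -- per `(d, b)`: sifting identity
  have hmain : ∀ d ∈ Dset, ∀ b ∈ Icc 1 B,
      |∑ t ∈ (Icc 1 (u / b)).filter (fun t => Nat.Coprime t P),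
          (if d ∣ b * t + 2 then (liouville (b * t + 2) : ℝ) else 0) -
        ∑ e ∈ E, (moebius e : ℝ) * G d (b * e)| ≤
      ∑ t ∈ Sp (u / b), (σ 0 t : ℝ) * (if d ∣ b * t + 2 then 1 else 0) := by
    intro d _ b hb
    rw [Finset.mem_Icc] at hb
    set g : ℕ → ℝ := fun t => if Odd t ∧ d ∣ b * t + 2 then (liouville (b * t + 2) : ℝ) else 0
      with hg
    -- (i) rough `t` are odd
    have h1 : ∑ t ∈ (Icc 1 (u / b)).filter (fun t => Nat.Coprime t P),
        (if d ∣ b * t + 2 then (liouville (b * t + 2) : ℝ) else 0) =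
        ∑ t ∈ (Icc 1 (u / b)).filter (fun t => Nat.Coprime t P), g t := by
      refine Finset.sum_congr rfl fun t ht => ?_
      rw [Finset.mem_filter] at ht
      have hodd : Odd t := odd_of_coprime_primorial hN ht.2
      simp only [hg, hodd, true_and]
    -- (ii) sifting with truncation
    have h2 := abs_sum_rough_sub_truncated_le N (u / b) Y g
    -- (iii) the truncated main term equals `∑_{e ∈ E} μ(e) G d (be)`
    have h3 : ∑ e ∈ (primorial (N - 1)).divisors.filter (fun e : ℕ => (e : ℝ) < Y),
        (moebius e : ℝ) * ∑ s ∈ Icc 1 (u / b / e), g (e * s) =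
        ∑ e ∈ E, (moebius e : ℝ) * G d (b * e) := by
      conv_rhs => rw [hEdef, Finset.sum_filter]
      rw [← hPdef]
      refine Finset.sum_congr rfl fun e he => ?_
      have he0 : 0 < e := Nat.pos_of_mem_divisors (Finset.mem_filter.mp he).1
      by_cases heo : Odd e
      · rw [if_pos heo]
        congr 1
        simp only [hg, hGdef]
        rw [Nat.div_div_eq_div_mul, Finset.sum_filter]
        refine Finset.sum_congr rfl fun s _ => ?_
        have : Odd (e * s) ↔ Odd s := by rw [Nat.odd_mul]; exact and_iff_right heo
        simp only [this, ← mul_assoc]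
      · rw [if_neg heo]
        convert mul_zero _ using 2
        refine Finset.sum_eq_zero fun s _ => ?_
        simp only [hg]
        rw [if_neg]
        rintro ⟨hodd, -⟩
        exact heo (Nat.odd_mul.mp hodd).1
    rw [h1, ← h3, ← hPdef]
    refine h2.trans (Finset.sum_le_sum fun t _ => ?_)
    rw [← ArithmeticFunction.sigma_zero_apply]
    refine mul_le_mul_of_nonneg_left ?_ (Nat.cast_nonneg _)
    simp only [hg]
    split_ifs with h1 h2
    · exact Literature.NumberTheory.LFunctions.LiouvilleSum.abs_liouville_le_one _
    · exact absurd h1.2 h2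
    · simp
    · simp
  -- per `d`: main term identity and bound
  have hperd : ∀ d ∈ Dset,
      |∑ b ∈ Icc 1 B, cb b * ∑ t ∈ (Icc 1 (u / b)).filter (fun t => Nat.Coprime t P),
          (if d ∣ b * t + 2 then (liouville (b * t + 2) : ℝ) else 0)| ≤
      |∑ r ∈ (Icc 1 R).filter (fun r => Odd r), C r * G d r| +
        ∑ b ∈ Icc 1 B, ∑ t ∈ Sp (u / b), (σ 0 t : ℝ) * (if d ∣ b * t + 2 then 1 else 0) := by
    intro d hd
    have hid : ∑ b ∈ Icc 1 B, cb b * ∑ e ∈ E, (moebius e : ℝ) * G d (b * e) =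
        ∑ r ∈ (Icc 1 R).filter (fun r => Odd r), C r * G d r := by
      rw [hCid (G d), Finset.sum_filter]
      refine Finset.sum_congr rfl fun r _ => ?_
      by_cases hr : C r = 0
      · simp [hr]
      · rw [if_pos (hCodd r hr)]
    rw [← hid]
    have hdiff : |∑ b ∈ Icc 1 B, cb b * ∑ t ∈ (Icc 1 (u / b)).filter (fun t => Nat.Coprime t P),
          (if d ∣ b * t + 2 then (liouville (b * t + 2) : ℝ) else 0) -
        ∑ b ∈ Icc 1 B, cb b * ∑ e ∈ E, (moebius e : ℝ) * G d (b * e)| ≤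
        ∑ b ∈ Icc 1 B, ∑ t ∈ Sp (u / b), (σ 0 t : ℝ) * (if d ∣ b * t + 2 then 1 else 0) := by
      rw [← Finset.sum_sub_distrib]
      refine (Finset.abs_sum_le_sum_abs _ _).trans (Finset.sum_le_sum fun b hb => ?_)
      rw [← mul_sub, abs_mul]
      calc |cb b| * _ ≤ 1 * ∑ t ∈ Sp (u / b), (σ 0 t : ℝ) * (if d ∣ b * t + 2 then 1 else 0) :=
            mul_le_mul (hcb1 b) (hmain d hd b hb) (abs_nonneg _) zero_le_one
        _ = _ := one_mul _
    have := abs_sub_abs_le_abs_sub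
      (∑ b ∈ Icc 1 B, cb b * ∑ t ∈ (Icc 1 (u / b)).filter (fun t => Nat.Coprime t P),
        (if d ∣ b * t + 2 then (liouville (b * t + 2) : ℝ) else 0))
      (∑ b ∈ Icc 1 B, cb b * ∑ e ∈ E, (moebius e : ℝ) * G d (b * e))
    linarith
  -- sum over `d`
  refine (Finset.sum_le_sum hperd).trans ?_
  rw [Finset.sum_add_distrib]
  have hR : (R : ℝ) ≤ (x : ℝ) ^ (1 / 3 - δ / 2) := Nat.floor_le (by positivity)
  have hT' := hT x hx₁ u hu R hR C hC1
  have htail := (sifting_tail_le Dset B u N Y).trans (hS x u N hx16 hu hN hNx hcN hNhi)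
  simp only [hGdef] at hT' ⊢
  refine (add_le_add hT' htail).trans ?_
  -- `(1 + K) x/(log x)^{A+1} ≤ x/(log x)^A`
  have hpow : Real.log x ^ (A + 1) = Real.log x ^ A * Real.log x := by
    rw [Real.rpow_add hlog0, Real.rpow_one]
  have hLA : 0 < Real.log x ^ A := Real.rpow_pos_of_pos hlog0 _
  rw [hpow]
  have e : (x : ℝ) / (Real.log x ^ A * Real.log x) + K * x / (Real.log x ^ A * Real.log x) =
      ((x : ℝ) / Real.log x ^ A) * ((1 + K) / Real.log x) := by
    field_simp
  rw [e]
  have h1 : (1 + K) / Real.log x ≤ 1 := by rw [div_le_one hlog0]; linarith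
  calc ((x : ℝ) / Real.log x ^ A) * ((1 + K) / Real.log x) ≤ ((x : ℝ) / Real.log x ^ A) * 1 :=
        mul_le_mul_of_nonneg_left h1 (by positivity)
    _ = (x : ℝ) / Real.log x ^ A := mul_one _

end Summit.Parity.GeneralizedHardyLittlewood.Theorems
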